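import Summits.BirchSwinnertonDyer.BirchSwinnertonDyer.Theorems.ErratumRoadFiveEulerHalfGenusFrameArith
import Summits.BirchSwinnertonDyer.BirchSwinnertonDyer.Theorems.AdditiveBranchIMCMultLowerFieldSupplyMSign
import Summits.BirchSwinnertonDyer.BirchSwinnertonDyer.Theorems.AdditiveBranchIMCGordTwoRankZeroOffCaseOneFieldSupplyR0Local
import Summits.BirchSwinnertonDyer.BirchSwinnertonDyer.Theorems.AdditiveBranchIMCGenusGrossZagierHeegnerOne
import Summits.BirchSwinnertonDyer.Rank1Residual.X11b.Three.UpperHalfLocalMult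
import Summits.BirchSwinnertonDyer.Rank1Residual.AdditivePotMult.PStarTwistModel
import Summits.BirchSwinnertonDyer.Rank1Residual.Additive.SharpenedStatements
import Literature.NumberTheory.EllipticCurves.NonvanishingTwistsHoffsteinLuo
import Literature.NumberTheory.EllipticCurves.NonvanishingTwistsProofs
import Literature.NumberTheory.EllipticCurves.QuadraticTwistKroneckerRootNumberProofs
import Literature.NumberTheory.EllipticCurves.QuadraticTwistPadicReduction
import Literature.NumberTheory.EllipticCurves.GlobalMinimalModelProofs
import Literature.NumberTheory.EllipticCurves.HeegnerPointsImaginaryQuadraticProofs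
import Literature.NumberTheory.QuadraticFields.FundamentalDiscriminant
import HarnessLib

/-!
# Euler-system half at `p ≥ 5`, crux `ErratumRoadFive.EulerHalfNotRamNoInertSetAtFive` (item stmt-BirchSwinnertonDyer-19715), crux idea
# `ramified-twin-ram-transport` — the GENUS FRAME'S TWIST SUPPLY, part 2: `GenusFrameTwistSupply` at `q ≥ 5` from Hoffstein–Luo 1997
# and the Modularity Theorem, NO new named fact

Width seat `bsd-line-er5-p1-w6` g9 (cell `bsd-stepL`); helper `--supports stmt-BirchSwinnertonDyer-19715`; THEOREMS ONLY (no definition, no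
named fact, no `sorry`). Sequel of part 1 `…ErratumRoadFiveEulerHalfGenusFrameArith` (auxiliary prime, Jacobi bookkeeping).

## What

The idea card (`Cruxes/EulerHalfNotRamNoInertSetAtFive/Ideas/ramified-twin-ram-transport.md`, bsd-idea-9 g14; Sketch.lean = evidence #55, 4th
typed statement `GenusFrameTwistSupply`) needs, for an S1b curve `E` (root number `−1`) with an odd additive POTENTIALLY MULTIPLICATIVE
prime `q`, an imaginary quadratic `K` RAMIFIED at `q`, every other bad prime SPLIT, the twin `E^{(d_K)}` NON-SPLIT multiplicative at `q`
(Cai–Shu–Tian's Heegner condition (2) for `(E ⊗ χ_{q*}, K, χ₀)`; then (ram) at `q` — the card's first lemma, seat -w5 — with `≥`-half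
Skinner 2016 Thm. C — seat -w8), and `L(E^{(d_K)},1) ≠ 0`, printed as «a Friedberg–Hoffstein Thm. B instance». The tree's typed FH special
cases all ramify `K` at a MULTIPLICATIVE prime of the curve; this file shows NO NEW FACT is needed at `q ≥ 5`: the supply follows from
Hoffstein–Luo 1997 (`hHL`, split prescriptions only, sign-agnostic — already a conjunct of the route item `PublishedInputsFive`) and
Modularity (`hmod`), along bsd-addord's FIELD-2 recipe for the (M) cell of crux `MultLower`
(`ThreeFieldRoadSupply.exists_ramifiedClass_partner_mult`) over bsd-wall's habitat sign law
(`AdditiveKoly.RamifiedHabitat.rootNumber_mul_rootNumber_ramifiedTwist_of_potMult_anyLevel`, read from a multiplicative twist model by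
`ThreeFieldRoadSupply.rootNumber_mul_rootNumber_ramifiedTwist_of_mult_model`):
* §3 `exists_pos_twist_L_ne_zero` — for ANY `X/ℚ` with `w(X) = +1`, finite `S`, bound `B`: a square-free `n > B`, `n ≡ 1 (mod 8)`,
  `(n/ℓ) = 1` at the odd primes of `S` and of `N_X`, `L(X^{(n)},1) ≠ 0`; Hoffstein–Luo's `n` is POSITIVE since `L ≠ 0` forces
  `w(X^{(n)}) = +1 = (−1/|n|)(N_X/|n|) w(X) = (−1/|n|)` (coprime twisting law; part 1's `jacobiSym_natCast_natAbs_eq_one`).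
* §4 `exists_auxTwist_rootNumber_one` — part 1's auxiliary prime `ℓ₀` (`D₀ = q*ℓ₀* < 0`, `≡ 1 (mod 8)`, `(D₀/ℓ) = 1` at the odd bad
  `ℓ ≠ q`, `(ℓ₀*/q) = −a_q(V)` for the multiplicative twist model `C • V^{(q*)} = E`) and `w(E^{(D₀)}) = +1` by the (M)-cell sign law.
* §5 `genusFrameTwistSupply_of_hoffsteinLuo` — THE SUPPLY: `d_K = D₀·n`, `K` by `exists_heegnerField_iff_exists_fundamental`; the twin
  `Wd = Cd • E^{(d_K)} ≅ V^{(ℓ₀*n)}` globally minimal, MULTIPLICATIVE at `q` and NON-SPLIT (`(ℓ₀*n/q) = −1` flips a split `V`: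
  `X11b.Three.split_twist_iff_not_split_of_jacobiSym`; `= +1` keeps a non-split `V`: `hasSplitMultiplicativeReductionAtPrime_quadraticTwist_iff`);
  `L(E^{(d_K)},1) ≠ 0` as `E^{(d_K)} = (E^{(D₀)})^{(n)}` on the nose; `|d_K| > B`, `d_K ≡ 1 (mod 8)`, `q ∥ d_K`, every bad `ℓ ≠ q` split.
* §6 `genusFrameTwistSupply_five_le` — the Sketch's statement VERBATIM with `q ≠ 2` sharpened to `5 ≤ q` (the sign law reads Rohrlich's
  local root number at `q`, junk at `q = 3` in the tree's `localRootNumber`), under the two named facts.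

HONEST FRAMING: CONDITIONAL on `hHL` (Hoffstein–Luo 1997) and `hmod` (Modularity, BCDT 2001); `q = 3` NOT covered; SUPPLY leg only — the
Euler-system half of the card (the `χ₀`-transported Kolyvagin system of `E ⊗ χ_{q*}` over `K`: bsd-addord's `GenusKolyvagin.*` ∕
`kolyvaginGenusIndexBound_of_leaves` pattern, plus Jetchev-sharpness at the carrier `p`) is untouched; no stub of line `birth` v17 exists
or is closed; crux 19715 stays closed modulo its route items; BSD is proved for no curve.

References: [cite: HoffsteinLuo1997, Theorem (§1, pp. 435–436)] [cite: FriedbergHoffstein1995, Thm. B] [cite: BCDTJAMS2001, Theorem A]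
[cite: Rohrlich1993Compositio, Prop. 2(ii),(iii)] [cite: AtkinLehner1970, §6] [cite: MurtyMurty1997, Ch. 6 §1] [cite: SilvermanAEC2009, X.5 Cor. 5.4].
-/

set_option autoImplicit false
-- D-0017: single-problem summit, so `Summit.BirchSwinnertonDyer.BirchSwinnertonDyer.…` repeats the name by design
set_option linter.dupNamespace false

noncomputable section

open scoped Classical NumberTheorySymbols

namespace Summit.BirchSwinnertonDyer.BirchSwinnertonDyer.Theorems.EulerHalfGenusFrame

open WeierstrassCurve NumberField Literature.NumberTheory.EllipticCurves
  Literature.NumberTheory.EllipticCurves.ModularForms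
  Literature.NumberTheory.EllipticCurves.Rank1Residual
  Summit.BirchSwinnertonDyer.Rank1Residual
  Summit.BirchSwinnertonDyer.BirchSwinnertonDyer.Theorems.ThreeFieldRoadSupply

/-! ## §3 A POSITIVE non-vanishing Hoffstein–Luo twist of a curve of root number `+1` -/

/-- **A POSITIVE non-vanishing quadratic twist with prescribed splitting, for a curve of root number `+1`.** For `X/ℚ` elliptic with
`w(X) = +1`, a finite set `S` and a bound `B`: a square-free `n > B`, `n ≡ 1 (mod 8)`, with `(n/ℓ) = 1` at every odd prime `ℓ ∈ S`
and at every odd prime of `N_X`, and `L(X^{(n)}, 1) ≠ 0`. Hoffstein–Luo 1997 (`hHL`) gives such an `n` of unknown sign; its sign is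
`+1` because `L(X^{(n)},1) ≠ 0` forces `w(X^{(n)}) = +1` (`rootNumber_eq_one_of_entireLFunction_one_ne_zero`) while the coprime
twisting law (`rootNumber_quadraticTwist_of_emod_four_eq_one`, Modularity `hmod`) reads `w(X^{(n)}) = (−1/|n|)(N_X/|n|) w(X) = (−1/|n|)`.
[cite: HoffsteinLuo1997, Theorem (§1, pp. 435–436)] [cite: MurtyMurty1997, Ch. 6 §1] -/
theorem exists_pos_twist_L_ne_zero (hHL : HoffsteinLuo1997_exists_twist_L_one_ne_zero) (hmod : exists_isNewformOf)
    (X : WeierstrassCurve ℚ) [X.IsElliptic] (hX : X.rootNumber = 1) (S : Finset ℕ) (B : ℕ) :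
    ∃ n : ℤ, 0 < n ∧ (B : ℤ) < n ∧ Squarefree n ∧ n % 8 = 1 ∧
      (∀ ℓ ∈ S, ℓ.Prime → ℓ ≠ 2 → J(n | ℓ) = 1) ∧
      (∀ ℓ : ℕ, ℓ.Prime → ℓ ∣ X.conductorNorm ℤ → ℓ ≠ 2 → J(n | ℓ) = 1) ∧
      (X.quadraticTwist (n : ℚ)).entireLFunction 1 ≠ 0 := by
  have hN0 : X.conductorNorm ℤ ≠ 0 := (X.conductorNorm_pos_holds).ne'
  set S' : Finset ℕ := S ∪ (X.conductorNorm ℤ).primeFactors with hS'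
  obtain ⟨n, hBn, hnsq, hn8, -, hJ, hL⟩ := hHL X S' B
  have hn4 : n % 4 = 1 := by omega
  have hn0 : n ≠ 0 := fun h ↦ by simp [h] at hn8
  have hJS : ∀ ℓ ∈ S, ℓ.Prime → ℓ ≠ 2 → J(n | ℓ) = 1 := fun ℓ hℓ hℓp hℓ2 ↦
    hJ ℓ (Finset.mem_union_left _ hℓ) hℓp hℓ2
  have hJN : ∀ ℓ : ℕ, ℓ.Prime → ℓ ∣ X.conductorNorm ℤ → ℓ ≠ 2 → J(n | ℓ) = 1 := fun ℓ hℓp hℓN hℓ2 ↦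
    hJ ℓ (Finset.mem_union_right _ (Nat.mem_primeFactors.mpr ⟨hℓp, hℓN, hN0⟩)) hℓp hℓ2
  have hgcd : Int.gcd n (X.conductorNorm ℤ) = 1 := int_gcd_eq_one_of_forall_prime (by omega) hJN
  -- the sign
  obtain ⟨hw, -⟩ := X.rootNumber_quadraticTwist_of_emod_four_eq_one hmod hn4 hnsq hgcd
  haveI : (X.quadraticTwist (n : ℚ)).IsElliptic := X.isElliptic_quadraticTwist (by exact_mod_cast hn0)
  have hw1 : (X.quadraticTwist (n : ℚ)).rootNumber = 1 := rootNumber_eq_one_of_entireLFunction_one_ne_zero hL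
  have hJNX : J((X.conductorNorm ℤ : ℤ) | n.natAbs) = 1 := jacobiSym_natCast_natAbs_eq_one hn8 hN0 hJN
  rw [hw1, hJNX, hX, mul_one, mul_one] at hw
  have hpos : 0 < n := pos_of_jacobiSym_neg_one_natAbs hn4 hw.symm
  refine ⟨n, hpos, ?_, hnsq, hn8, hJS, hJN, hL⟩
  have : (n.natAbs : ℤ) = n := Int.natAbs_of_nonneg hpos.le
  omega

/-! ## §4 The auxiliary twist `X₀ = E^{(q*ℓ₀*)}` of root number `+1` -/

/-- **The auxiliary twist of the genus frame.** `W/ℚ` global minimal with `w(E) = −1`, `q ≥ 5` additive with a multiplicative twist model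
`C • V^{(q*)} = W` (`V` multiplicative at `q`: the potentially multiplicative row). For every bound `B` there is a prime `ℓ₀ > B`,
`ℓ₀ ∉ {2, q}`, `ℓ₀ ∤ N_E`, with `D₀ := q*·ℓ₀* < 0`, `D₀ ≡ 1 (mod 8)`, `(D₀/ℓ) = 1` at every odd bad prime `ℓ ≠ q`, `(ℓ₀*/q) = −1` if `V` is
split and `+1` if `V` is non-split at `q` — so that EVERY twist `V^{(ℓ₀*n)}` with `(n/q) = 1` is NON-SPLIT multiplicative at `q` — and
`w(E^{(D₀)}) = +1`: by the (M)-cell sign law `w(E)·w(E^{(q*d′)}) = −(d′/q)·W_q(V)` (bsd-addord's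
`ThreeFieldRoadSupply.rootNumber_mul_rootNumber_ramifiedTwist_of_mult_model` over bsd-wall's Atkin–Lehner/Rohrlich habitat sign law; Modularity
`hmod` only) the product is `−(ℓ₀*/q)·(−a_q(V)) = −1`. [cite: Rohrlich1993Compositio, Prop. 2(ii),(iii)] [cite: AtkinLehner1970, §6]
[cite: IrelandRosen1990, Ch. 16 §1] -/
theorem exists_auxTwist_rootNumber_one (hmod : exists_isNewformOf)
    (W : WeierstrassCurve ℚ) [W.IsElliptic] [W.IsGloballyMinimal] (hw : W.rootNumber = -1)
    (q : ℕ) [hq : Fact q.Prime] (hq5 : 5 ≤ q) (hadd : Addv W q)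
    (V : WeierstrassCurve ℚ) [V.IsElliptic] (C : VariableChange ℚ)
    (hC : C • V.quadraticTwist ((-1 : ℚ) ^ (q / 2) * q) = W) (hmultV : V.HasMultiplicativeReductionAtPrime q) (B : ℕ) :
    ∃ ℓ₀ : ℕ, ℓ₀.Prime ∧ B < ℓ₀ ∧ ℓ₀ ≠ 2 ∧ ℓ₀ ≠ q ∧ ¬ ℓ₀ ∣ W.conductorNorm ℤ ∧
      (-1 : ℤ) ^ (q / 2) * q * ((-1 : ℤ) ^ (ℓ₀ / 2) * ℓ₀) < 0 ∧
      ((-1 : ℤ) ^ (q / 2) * q * ((-1 : ℤ) ^ (ℓ₀ / 2) * ℓ₀)) % 8 = 1 ∧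
      J((-1 : ℤ) ^ (ℓ₀ / 2) * ℓ₀ | q) = (if V.HasSplitMultiplicativeReductionAtPrime q then -1 else 1) ∧
      (∀ ℓ : ℕ, ℓ.Prime → ℓ ∣ W.conductorNorm ℤ → ℓ ≠ q → ℓ ≠ 2 →
        J((-1 : ℤ) ^ (q / 2) * q * ((-1 : ℤ) ^ (ℓ₀ / 2) * ℓ₀) | ℓ) = 1) ∧
      (W.quadraticTwist (((-1 : ℤ) ^ (q / 2) * q * ((-1 : ℤ) ^ (ℓ₀ / 2) * ℓ₀) : ℤ) : ℚ)).rootNumber = 1 := by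
  have hqp : q.Prime := hq.out
  have hq2 : q ≠ 2 := by omega
  have hN0 : W.conductorNorm ℤ ≠ 0 := (W.conductorNorm_pos_holds).ne'
  obtain ⟨M, hN, hqM⟩ := conductorNorm_eq_mul_sq_of_addv W q hq5 hadd
  have hM0 : M ≠ 0 := by
    intro h; rw [h, zero_mul] at hN; exact hN0 hN
  -- the class at `q` that makes the twin non-split
  set ε : ℤ := if V.HasSplitMultiplicativeReductionAtPrime q then -1 else 1 with hε
  have hε1 : ε = 1 ∨ ε = -1 := by
    by_cases h : V.HasSplitMultiplicativeReductionAtPrime q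
    · exact Or.inr (by simp [hε, h])
    · exact Or.inl (by simp [hε, h])
  obtain ⟨ℓ₀, hℓ₀, hBℓ₀, hℓ₀2, hℓ₀q, hℓ₀M, hneg, h8, hJq, hJM⟩ := exists_auxPrime hqp hq2 hε1 hM0 hqM B
  haveI : Fact ℓ₀.Prime := ⟨hℓ₀⟩
  -- `ℓ₀ ∤ N = M q²`
  have hℓ₀N : ¬ ℓ₀ ∣ W.conductorNorm ℤ := by
    rw [hN]
    intro h
    rcases (Nat.Prime.dvd_mul hℓ₀).mp h with h | h
    · exact hℓ₀M h
    · exact hℓ₀q ((Nat.prime_dvd_prime_iff_eq hℓ₀ hqp).mp (hℓ₀.dvd_of_dvd_pow h))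
  -- bad primes `≠ q` divide `M`
  have hbadM : ∀ ℓ : ℕ, ℓ.Prime → ℓ ∣ W.conductorNorm ℤ → ℓ ≠ q → ℓ ∣ M := by
    intro ℓ hℓ hℓN hℓq
    rw [hN] at hℓN
    rcases (Nat.Prime.dvd_mul hℓ).mp hℓN with h | h
    · exact h
    · exact absurd ((Nat.prime_dvd_prime_iff_eq hℓ hqp).mp (hℓ.dvd_of_dvd_pow h)) hℓq
  set qs : ℤ := (-1 : ℤ) ^ (q / 2) * q with hqs
  set ls : ℤ := (-1 : ℤ) ^ (ℓ₀ / 2) * ℓ₀ with hls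
  have hls4 : ls % 4 = 1 := AdditiveKoly.RamifiedHabitat.pStar_emod_four (p := ℓ₀) hℓ₀2
  have hlssq : Squarefree ls := squarefree_pStar (p := ℓ₀)
  have hgcd : Int.gcd ls (W.conductorNorm ℤ) = 1 := by
    rw [Int.gcd_eq_natAbs, Int.natAbs_natCast, hls, natAbs_pStar (p := ℓ₀)]
    exact (Nat.Prime.coprime_iff_not_dvd hℓ₀).mpr hℓ₀N
  -- `(q* ℓ₀* / ℓ) = (q*/ℓ)² = 1` at the odd bad primes `ℓ ≠ q`
  have hodd : ∀ ℓ : ℕ, ℓ.Prime → ℓ ∣ W.conductorNorm ℤ → ℓ ≠ q → ℓ ≠ 2 → J(qs * ls | ℓ) = 1 := by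
    intro ℓ hℓ hℓN hℓq hℓ2
    rw [jacobiSym.mul_left, hJM ℓ hℓ (hbadM ℓ hℓ hℓN hℓq) hℓ2]
    rcases jacobiSym.eq_one_or_neg_one (int_gcd_pStar_eq_one hqp hℓ hℓq) with h | h <;>
      simp [hqs, h]
  have htwo : 2 ∣ W.conductorNorm ℤ → (qs * ls) % 8 = 1 := fun _ ↦ h8
  -- the sign law on the (M) cell
  have hsl := rootNumber_mul_rootNumber_ramifiedTwist_of_mult_model W q hmod hq5 hadd V C hC hmultV hls4 hlssq hgcd
    hneg hodd htwo
  have hleg : legendreSym q ls = ε := by rw [jacobiSym.legendreSym.to_jacobiSym, hJq]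
  rw [hleg, hw] at hsl
  have hεε : ε * ε = 1 := by rcases hε1 with h | h <;> simp [h]
  have hX : (W.quadraticTwist (((qs * ls : ℤ)) : ℚ)).rootNumber = 1 := by
    have : -ε * (if V.HasSplitMultiplicativeReductionAtPrime q then (-1 : ℤ) else 1) = -1 := by
      change -ε * ε = -1; linear_combination (-1 : ℤ) * hεε
    rw [this] at hsl
    linarith
  exact ⟨ℓ₀, hℓ₀, hBℓ₀, hℓ₀2, hℓ₀q, hℓ₀N, hneg, h8, hJq, hodd, hX⟩

/-! ## §5 THE SUPPLY: the genus-frame Kolyvagin field `K = ℚ(√(q*·ℓ₀*·n))` and its twin -/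

/-- **`GenusFrameTwistSupply` at `q ≥ 5`, from Hoffstein–Luo 1997 and the Modularity Theorem — NO new named fact** (crux idea
`ramified-twin-ram-transport`, 4th typed statement; here with `q ≠ 2` sharpened to `5 ≤ q`, a bound `B`, `d_K ≡ 1 (mod 8)` and
`Squarefree d_K` added). For `E/ℚ` globally minimal of root number `−1` and an additive POTENTIALLY MULTIPLICATIVE prime `q ≥ 5`: an imaginary
quadratic `K` with `|d_K| > B`, `d_K ≡ 1 (mod 8)`, `q ∣ d_K` square-free (`K` RAMIFIED at `q`), every bad prime `ℓ ≠ q` SPLIT, a globally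
minimal model `Wd = Cd • E^{(d_K)}` MULTIPLICATIVE and NON-SPLIT at `q`, and `L(E^{(d_K)}, 1) ≠ 0`. Construction `d_K = q*·ℓ₀*·n` (module
docstring §§3–5). CONDITIONAL on `hHL` and `hmod` only. [cite: HoffsteinLuo1997, Theorem (§1, pp. 435–436)] [cite: FriedbergHoffstein1995, Thm. B]
[cite: SilvermanAEC2009, X.5 Cor. 5.4, VII.5 Prop. 5.1] [cite: Rohrlich1993Compositio, Prop. 2(ii),(iii)] -/
theorem genusFrameTwistSupply_of_hoffsteinLuo
    (hHL : HoffsteinLuo1997_exists_twist_L_one_ne_zero) (hmod : exists_isNewformOf)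
    (W : WeierstrassCurve ℚ) [W.IsElliptic] [W.IsGloballyMinimal] (hw : W.rootNumber = -1)
    (q : ℕ) [hq : Fact q.Prime] (hq5 : 5 ≤ q) (hadd : Addv W q) (hpm : Additive.PotMult W q) (B : ℕ) :
    ∃ (K : Type) (_ : Field K) (_ : NumberField K) (Wd : WeierstrassCurve ℚ) (_ : Wd.IsElliptic)
      (_ : Wd.IsGloballyMinimal) (Cd : VariableChange ℚ),
      IsImaginaryQuadratic K ∧ B < (NumberField.discr K).natAbs ∧ NumberField.discr K % 8 = 1 ∧
      (q : ℤ) ∣ NumberField.discr K ∧ Squarefree (NumberField.discr K) ∧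
      (∀ ℓ : ℕ, ℓ.Prime → ℓ ∣ W.conductorNorm ℤ → ℓ ≠ q →
        ((Ideal.span {(ℓ : ℤ)}).primesOver (𝓞 K)).ncard = 2) ∧
      Cd • W.quadraticTwist (NumberField.discr K : ℚ) = Wd ∧
      Wd.HasMultiplicativeReductionAtPrime q ∧ ¬ Wd.HasSplitMultiplicativeReductionAtPrime q ∧
      (W.quadraticTwist (NumberField.discr K : ℚ)).entireLFunction 1 ≠ 0 := by
  have hqp : q.Prime := hq.out
  have hq2 : q ≠ 2 := by omega
  have hN0 : W.conductorNorm ℤ ≠ 0 := (W.conductorNorm_pos_holds).ne'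
  obtain ⟨M, hN, hqM⟩ := conductorNorm_eq_mul_sq_of_addv W q hq5 hadd
  have hqN : q ∣ W.conductorNorm ℤ := by rw [hN]; exact Dvd.intro (M * q) (by ring)
  -- the multiplicative twist model at `q` (the potentially multiplicative row)
  obtain ⟨V, _, _, C, hmultV, hC⟩ :=
    AdditivePotMult.PotMult.exists_mult_pStar_twist_model (W := W) (p := q) ⟨hadd, hpm⟩ hq2
  -- the auxiliary prime `ℓ₀` and the auxiliary twist `X₀ = E^{(q*ℓ₀*)}` of root number `+1`
  obtain ⟨ℓ₀, hℓ₀, -, hℓ₀2, hℓ₀q, hℓ₀N, hneg, h8, hJq, hodd, hX₀⟩ :=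
    exists_auxTwist_rootNumber_one hmod W hw q hq5 hadd V C hC hmultV 0
  haveI : Fact ℓ₀.Prime := ⟨hℓ₀⟩
  set qs : ℤ := (-1 : ℤ) ^ (q / 2) * q with hqs
  set ls : ℤ := (-1 : ℤ) ^ (ℓ₀ / 2) * ℓ₀ with hls
  have hD₀0 : qs * ls ≠ 0 := hneg.ne
  have hD₀q : ((qs * ls : ℤ) : ℚ) ≠ 0 := by exact_mod_cast hD₀0
  haveI hX₀E : (W.quadraticTwist ((qs * ls : ℤ) : ℚ)).IsElliptic := W.isElliptic_quadraticTwist hD₀q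
  -- Hoffstein–Luo's POSITIVE twisting parameter of `X₀`, split at `ℓ₀` and at the bad primes of `E`
  obtain ⟨n, hnpos, hBn, hnsq, hn8, hJS, -, hL⟩ :=
    exists_pos_twist_L_ne_zero hHL hmod (W.quadraticTwist ((qs * ls : ℤ) : ℚ)) hX₀
      (insert ℓ₀ (W.conductorNorm ℤ).primeFactors) B
  have hn4 : n % 4 = 1 := by omega
  have hn0 : n ≠ 0 := hnpos.ne'
  have hJbad : ∀ ℓ : ℕ, ℓ.Prime → ℓ ∣ W.conductorNorm ℤ → ℓ ≠ 2 → J(n | ℓ) = 1 := fun ℓ hℓ hℓN hℓ2 ↦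
    hJS ℓ (Finset.mem_insert_of_mem (Nat.mem_primeFactors.mpr ⟨hℓ, hℓN, hN0⟩)) hℓ hℓ2
  have hJnq : J(n | q) = 1 := hJbad q hqp hqN hq2
  have hJnℓ₀ : J(n | ℓ₀) = 1 := hJS ℓ₀ (Finset.mem_insert_self _ _) hℓ₀ hℓ₀2
  have hqn : ¬ (q : ℤ) ∣ n := not_dvd_of_jacobiSym_eq_one hqp hJnq
  have hℓ₀n : ¬ (ℓ₀ : ℤ) ∣ n := not_dvd_of_jacobiSym_eq_one hℓ₀ hJnℓ₀
  -- the discriminant `D = q* ℓ₀* n`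
  set D : ℤ := qs * ls * n with hD
  have hDneg : D < 0 := mul_neg_of_neg_of_pos hneg hnpos
  have hD8 : D % 8 = 1 := by rw [hD, Int.mul_emod, h8, hn8]; norm_num
  have hD4 : D % 4 = 1 := by omega
  have hD1 : D ≠ 1 := by omega
  have hqssq : Squarefree qs := squarefree_pStar (p := q)
  have hlssq : Squarefree ls := squarefree_pStar (p := ℓ₀)
  have hls4 : ls % 4 = 1 := AdditiveKoly.RamifiedHabitat.pStar_emod_four (p := ℓ₀) hℓ₀2
  have hcop1 : IsCoprime qs ls := by
    rw [Int.isCoprime_iff_gcd_eq_one, Int.gcd_eq_natAbs, hqs, hls, natAbs_pStar (p := q), natAbs_pStar (p := ℓ₀)]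
    exact (Nat.coprime_primes hqp hℓ₀).mpr (Ne.symm hℓ₀q)
  have hcop2 : IsCoprime ls n := by
    rw [Int.isCoprime_iff_gcd_eq_one, Int.gcd_eq_natAbs, hls, natAbs_pStar (p := ℓ₀)]
    exact (Nat.Prime.coprime_iff_not_dvd hℓ₀).mpr (fun h ↦ hℓ₀n (Int.natCast_dvd.mpr h))
  have hcop3 : IsCoprime qs n := by
    rw [Int.isCoprime_iff_gcd_eq_one, Int.gcd_eq_natAbs, hqs, natAbs_pStar (p := q)]
    exact (Nat.Prime.coprime_iff_not_dvd hqp).mpr (fun h ↦ hqn (Int.natCast_dvd.mpr h))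
  have husq : Squarefree (ls * n) := squarefree_mul_iff.mpr ⟨hcop2.isRelPrime, hlssq, hnsq⟩
  have hDsq : Squarefree D := by
    rw [hD, mul_assoc]
    exact squarefree_mul_iff.mpr ⟨(hcop1.mul_right hcop3).isRelPrime, hqssq, husq⟩
  have hBD : B < D.natAbs := by
    have h1 : n.natAbs ≤ D.natAbs := by
      rw [hD, Int.natAbs_mul]
      exact Nat.le_mul_of_pos_left _ (Int.natAbs_pos.mpr hD₀0)
    have h2 : (n.natAbs : ℤ) = n := Int.natAbs_of_nonneg hnpos.le
    omega
  -- bad primes `≠ q` divide `M`, and `(D/ℓ) = 1` there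
  have hbadM : ∀ ℓ : ℕ, ℓ.Prime → ℓ ∣ W.conductorNorm ℤ → ℓ ≠ q → ℓ ∣ M := by
    intro ℓ hℓ hℓN hℓq
    rw [hN] at hℓN
    rcases (Nat.Prime.dvd_mul hℓ).mp hℓN with h | h
    · exact h
    · exact absurd ((Nat.prime_dvd_prime_iff_eq hℓ hqp).mp (hℓ.dvd_of_dvd_pow h)) hℓq
  have hMN : ∀ ℓ : ℕ, ℓ ∣ M → ℓ ∣ W.conductorNorm ℤ := fun ℓ h ↦ by rw [hN]; exact h.mul_right _
  have hkron : ∀ p : ℕ, p.Prime → p ∣ M → (p = 2 → D % 8 = 1) ∧ (p ≠ 2 → jacobiSym D p = 1) := by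
    intro p hp hpM
    refine ⟨fun _ ↦ hD8, fun hp2 ↦ ?_⟩
    have hpq : p ≠ q := by rintro rfl; exact hqM hpM
    rw [hD, jacobiSym.mul_left, hodd p hp (hMN p hpM) hpq hp2, hJbad p hp (hMN p hpM) hp2, one_mul]
  -- the field
  obtain ⟨K, _, _, hK, hBK, hHM, hdK⟩ :=
    (exists_heegnerField_iff_exists_fundamental M B (fun D' ↦ D' = D)).mpr
      ⟨D, hDneg, Or.inl ⟨hD4, hDsq, hD1⟩, hBD, hkron, rfl⟩
  -- the twin's global minimal model
  have hDq0 : ((D : ℤ) : ℚ) ≠ 0 := by exact_mod_cast hDneg.ne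
  haveI hXDE : (W.quadraticTwist ((D : ℤ) : ℚ)).IsElliptic := W.isElliptic_quadraticTwist hDq0
  obtain ⟨Cd, hCd⟩ := hasGlobalMinimalModel_rat_holds (W.quadraticTwist ((D : ℤ) : ℚ))
  set Wd : WeierstrassCurve ℚ := Cd • W.quadraticTwist ((D : ℤ) : ℚ) with hWd_def
  haveI : Wd.IsGloballyMinimal := hCd
  -- `Wd ≅ V^{(u)}`, `u = ℓ₀* n`
  set u : ℤ := ls * n with hu
  have hu0 : u ≠ 0 := mul_ne_zero (by rw [hls]; exact mul_ne_zero (pow_ne_zero _ (by norm_num)) (by exact_mod_cast hℓ₀.ne_zero)) hn0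
  have hu0q : ((u : ℤ) : ℚ) ≠ 0 := by exact_mod_cast hu0
  have hqu : ¬ (q : ℤ) ∣ u := by
    rw [hu]; intro h
    rcases Int.Prime.dvd_mul' hqp h with h | h
    · apply hℓ₀q
      have h' : (q : ℤ) ∣ (ℓ₀ : ℤ) := by
        have hu' : IsUnit ((-1 : ℤ) ^ (ℓ₀ / 2)) := (isUnit_neg_one (α := ℤ)).pow _
        rw [hls] at h; exact (hu'.dvd_mul_left).mp h
      exact ((Nat.prime_dvd_prime_iff_eq hqp hℓ₀).mp (Int.natCast_dvd_natCast.mp h')).symm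
    · exact hqn h
  set qs' : ℚ := (-1 : ℚ) ^ (q / 2) * q with hqs'
  have hqs'0 : qs' ≠ 0 := mul_ne_zero (pow_ne_zero _ (by norm_num)) (by exact_mod_cast hqp.ne_zero)
  have hqscast : ((qs : ℤ) : ℚ) = qs' := by rw [hqs, hqs']; push_cast; ring
  haveI := V.isElliptic_quadraticTwist hqs'0
  haveI := V.isElliptic_quadraticTwist hu0q
  obtain ⟨C₂, hC₂⟩ := V.exists_variableChange_quadraticTwist_mul_sq ((u : ℤ) : ℚ) qs' hqs'0
  have hWD : W.quadraticTwist ((D : ℤ) : ℚ) =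
      ((⟨C.u, ((D : ℤ) : ℚ) * C.r, 0, 0⟩ : VariableChange ℚ) * C₂) • V.quadraticTwist ((u : ℤ) : ℚ) := by
    have hDcast : qs' * ((D : ℤ) : ℚ) = ((u : ℤ) : ℚ) * qs' ^ 2 := by
      rw [← hqscast, hD, hu]; push_cast; ring
    rw [← hC, WeierstrassCurve.quadraticTwist_smul, quadraticTwist_quadraticTwist, hDcast, ← hC₂, mul_smul]
  have hWdV : (Cd * (⟨C.u, ((D : ℤ) : ℚ) * C.r, 0, 0⟩ : VariableChange ℚ) * C₂) • V.quadraticTwist ((u : ℤ) : ℚ) = Wd := by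
    rw [hWd_def, hWD, mul_assoc, mul_smul]
  have hmultWd : Wd.HasMultiplicativeReductionAtPrime q := by
    rw [← hWdV, Literature.NumberTheory.EllipticCurves.hasMultiplicativeReductionAtPrime_smul_iff]
    exact (GenusGrossZagier.hasMultiplicativeReductionAtPrime_quadraticTwist_iff_of_odd V hq2 hu0 hqu).mpr hmultV
  -- … and NON-SPLIT
  have hu4 : u % 4 = 1 := by rw [hu, Int.mul_emod, hls4, hn4]; norm_num
  have hu1 : u ≠ 1 := by
    rw [hu]; intro h
    have habs : ls.natAbs * n.natAbs = 1 := by rw [← Int.natAbs_mul, h]; rfl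
    have hℓ₀abs : ls.natAbs = ℓ₀ := by rw [hls]; exact natAbs_pStar (p := ℓ₀)
    rw [hℓ₀abs] at habs
    exact hℓ₀.one_lt.ne' (Nat.eq_one_of_mul_eq_one_right habs)
  have hJu : J(u | q) = (if V.HasSplitMultiplicativeReductionAtPrime q then -1 else 1) := by
    rw [hu, jacobiSym.mul_left, hJq, hJnq, mul_one]
  have hnsWd : ¬ Wd.HasSplitMultiplicativeReductionAtPrime q := by
    by_cases hsV : V.HasSplitMultiplicativeReductionAtPrime q
    · -- `(u/q) = −1`: the twist of the split `V` is non-split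
      rw [if_pos hsV] at hJu
      obtain ⟨Ku, _, _, _, hdu⟩ :=
        Literature.NumberTheory.QuadraticFields.Quadratic.exists_numberField_discr_eq (D := u) (Or.inl ⟨hu4, husq, hu1⟩)
      have key := X11b.Three.split_twist_iff_not_split_of_jacobiSym V Ku (Wd := Wd)
        (Cd * (⟨C.u, ((D : ℤ) : ℚ) * C.r, 0, 0⟩ : VariableChange ℚ) * C₂) (by rw [hdu]; exact hWdV) q hq2
        (by rw [hdu]; exact hJu) hmultV
      exact fun h ↦ (key.mp h) hsV
    · -- `(u/q) = +1`: the twist of the non-split `V` is non-split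
      rw [if_neg hsV] at hJu
      have hsq : IsSquare (((u : ℤ) : ℚ) : ℚ_[q]) :=
        isSquare_padic_of_fundamental hu4 husq hu1 ⟨fun h2 ↦ absurd h2 hq2, fun _ ↦ hJu⟩
      have hsq' : IsSquare (algebraMap ℚ ℚ_[q] ((u : ℤ) : ℚ)) := by simpa using hsq
      rw [← hWdV, Literature.NumberTheory.EllipticCurves.hasSplitMultiplicativeReductionAtPrime_smul_iff,
        V.hasSplitMultiplicativeReductionAtPrime_quadraticTwist_iff hu0q hsq']
      exact hsV
  have hLD : (W.quadraticTwist ((D : ℤ) : ℚ)).entireLFunction 1 ≠ 0 := by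
    have : ((D : ℤ) : ℚ) = ((qs * ls : ℤ) : ℚ) * (n : ℚ) := by rw [hD]; push_cast; ring
    rw [this, ← quadraticTwist_quadraticTwist]
    exact hL
  refine ⟨K, inferInstance, inferInstance, Wd, inferInstance, hCd, Cd, hK, hBK, ?_, ?_, ?_, ?_, ?_, hmultWd, hnsWd, ?_⟩
  · rw [hdK]; exact hD8
  · rw [hdK]; exact ⟨(-1 : ℤ) ^ (q / 2) * (ls * n), by rw [hD, hqs]; ring⟩
  · rw [hdK]; exact hDsq
  · intro ℓ hℓ hℓN hℓq
    exact hHM ℓ hℓ (hbadM ℓ hℓ hℓN hℓq)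
  · rw [hdK]
  · rw [hdK]; exact hLD

/-! ## §6 `q ∥ d_K`, and the Sketch's shape -/

/-- `ord_q D = 1` for `D` square-free with `q ∣ D`. [folklore] -/
theorem padicValInt_eq_one_of_dvd_of_squarefree {q : ℕ} (hq : q.Prime) {D : ℤ} (hD : Squarefree D) (hqD : (q : ℤ) ∣ D) :
    padicValInt q D = 1 := by
  haveI : Fact q.Prime := ⟨hq⟩
  have hD0 : D ≠ 0 := hD.ne_zero
  have hDa0 : D.natAbs ≠ 0 := Int.natAbs_ne_zero.mpr hD0
  have hle : padicValNat q D.natAbs ≤ 1 := by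
    rw [← Nat.factorization_def _ hq]
    exact (Nat.squarefree_iff_factorization_le_one hDa0).mp (Int.squarefree_natAbs.mpr hD) q
  have hge : 1 ≤ padicValNat q D.natAbs := one_le_padicValNat_of_dvd hDa0 (Int.natCast_dvd.mp hqD)
  change padicValNat q D.natAbs = 1
  omega

/-- **The Sketch's `GenusFrameTwistSupply` (crux idea `ramified-twin-ram-transport`, evidence #55 on stmt-BirchSwinnertonDyer-19715) at
`q ≥ 5`, VERBATIM in its binders and conclusion** (`q ≠ 2` sharpened to `5 ≤ q`), from Hoffstein–Luo 1997 and Modularity by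
`genusFrameTwistSupply_of_hoffsteinLuo` with the bound `B = 4`. [cite: HoffsteinLuo1997, Theorem (§1, pp. 435–436)]
[cite: FriedbergHoffstein1995, Thm. B] -/
theorem genusFrameTwistSupply_five_le (hHL : HoffsteinLuo1997_exists_twist_L_one_ne_zero) (hmod : exists_isNewformOf) :
    ∀ (W : WeierstrassCurve ℚ) [W.IsElliptic] [W.IsGloballyMinimal], W.rootNumber = -1 →
      ∀ (q : ℕ) [Fact q.Prime], 5 ≤ q → Addv W q → Additive.PotMult W q →
      ∃ (K : Type) (_ : Field K) (_ : NumberField K) (Wd : WeierstrassCurve ℚ) (_ : Wd.IsElliptic) (_ : Wd.IsGloballyMinimal)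
        (Cd : WeierstrassCurve.VariableChange ℚ),
        IsImaginaryQuadratic K ∧ 4 < (NumberField.discr K).natAbs ∧ padicValInt q (NumberField.discr K) = 1 ∧
        (∀ ℓ : ℕ, ℓ.Prime → ℓ ∣ W.conductorNorm ℤ → ℓ ≠ q →
          ((Ideal.span {(ℓ : ℤ)}).primesOver (NumberField.RingOfIntegers K)).ncard = 2) ∧
        Cd • W.quadraticTwist (NumberField.discr K : ℚ) = Wd ∧
        Mult Wd q ∧ ¬ Wd.HasSplitMultiplicativeReductionAtPrime q ∧
        (W.quadraticTwist (NumberField.discr K : ℚ)).entireLFunction 1 ≠ 0 := by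
  intro W _ _ hw q _ hq5 hadd hpm
  obtain ⟨K, iF, iN, Wd, iE, iM, Cd, hK, hB, -, hqd, hsq, hsplit, hWd, hmult, hns, hL⟩ :=
    genusFrameTwistSupply_of_hoffsteinLuo hHL hmod W hw q hq5 hadd hpm 4
  exact ⟨K, iF, iN, Wd, iE, iM, Cd, hK, hB, padicValInt_eq_one_of_dvd_of_squarefree (Fact.out) hsq hqd, hsplit, hWd, hmult,
    hns, hL⟩

end Summit.BirchSwinnertonDyer.BirchSwinnertonDyer.Theorems.EulerHalfGenusFrame

end
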